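import Summits.HodgeConjecture.HodgeConjecture.Theorems.Ring2WeilCoverageCMFieldAllPrimesR
import Summits.HodgeConjecture.HodgeConjecture.Theorems.Ring2WeilCoverageCMFieldAllPrimesI
import HarnessLib

/-!
# Weil-type components over quartic CM fields, IX (part S): the Thue boxes — a small multiple `π·μ₀ = Nm(z)`
# for every prime element `π` of `ℤ[σ] = ℤ[√2]` split in `E = ℚ(√-(3+√2))`, with `N(μ₀) < 182`

research route conditional on HC_CM; not a corollary; Q11.4-sentence-2 already refuted in dim ≥ 3. Cell
`pub-hodge-ring2`, seat `ring2-b03` (gen 53); `HOME/WEIL-FAMILY-COVERAGE.md` §b03.5, seventh table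
(`E = F(η)`, `η² = σ = -3-√2`, `F = ℚ(√2)`, `R = S² + 6S + 7`); coordinates as in parts P/Q/R. The start of the
descent of part R: for a prime element `π` of `ℤ[σ]` at which `σ` is a square (the place splits in `E`), an
integral `z ∈ ℤ[η]` in the prime `𝔏 = (π, η - e)` over `π` with all four coordinates at most `m`, found by
pigeonhole, has `Nm(z) = π·μ₀` with `μ₀` totally positive and `N(μ₀) = Nm_{E/ℚ}(z)/N(π) < 182`:

* §1 the norm form `Nm_{E/ℚ}` of `ℤ[η]` in the basis `{1, ρ, η, ρη}`, `ρ = √2 = -σ - 3`: the sum of squares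
  `Q = (a² - 2b²)² + 7(c² - 2d²)² + 6m² - 8mn + 12n²` (`m = ac - 2bd`, `n = bc - ad`), hence `0 ≤ Q ≤ 182·M⁴` on the
  box `|·| ≤ M`; and `3(X - 3Y) = 3(A - 3B)² + 6B² + (3C - 11D)² + 14D² > 0`, so `Nm(z)` is totally positive;
* §2 `box_four_two`: pigeonhole for TWO linear forms in four variables mod `q` (`(m+1)⁴ > q²`, `m² < q`);
* §3 **`degOne_box`**: `π = u + vσ` degree-one of norm `ℓ` (Bezout data `t`, `γ`), `-t = e²` a square mod `ℓ`:
  part I's `box_four` on the linear form `z ↦ z(σ ↦ -t, η ↦ e)` gives `Nm(z) = π·μ₀`, `μ₀` totally positive,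
  `0 < N(μ₀) < 182`;
* §4 **`inert_box`**: `π = q` an inert rational prime (`2` a non-square) with `7` a square mod `q`: a square root
  `e₀ + e₁σ` of `σ` in `𝔽_q[σ] = 𝔽_{q²}` is written down from `c² = 7` by denesting
  (`√(-3-√2) = e₀' + e₁'√2`, `e₀'² = (-3 ± c)/2`, `e₁' = -1/(2e₀')`), and `box_four_two` on `x + (e₀ + e₁σ)y ≡ 0`
  gives `Nm(z) = q·μ₀`, `μ₀` totally positive, `0 < N(μ₀) < 182`.

No named fact, no definition, no `sorry`; nothing about the Hodge conjecture is asserted.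
References: [Deligne1982HodgeCycles] §4 p. 30 (1), Cor. 4.2; [Landherr1936HermitianForms]. -/

noncomputable section

set_option linter.dupNamespace false

open Polynomial

namespace Summit.HodgeConjecture.HodgeConjecture.Ring2.WeilCoverageCM

/-! ### §1 The norm form of `ℤ[η]` in the basis `{1, ρ, η, ρη}`, `ρ = -σ - 3 = √2` -/

/-- **`Nm_{E/ℚ}` as a sum of squares.** For `z = (c₀ + c₁ρ) + (c₂ + c₃ρ)η`, i.e. `x = (c₀ - 3c₁) - c₁σ`,
`y = (c₂ - 3c₃) - c₃σ`, the rational norm `Q = N(Nm(z)) = X² - 6XY + 7Y²` is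
`(c₀² - 2c₁²)² + 7(c₂² - 2c₃²)² + 6m² - 8mn + 12n²`, `m = c₀c₂ - 2c₁c₃`, `n = c₁c₂ - c₀c₃`. [folklore] -/
theorem normE_sos (c₀ c₁ c₂ c₃ : ℤ) :
    ((c₀ - 3 * c₁) ^ 2 - 7 * (-c₁) ^ 2 + 14 * (c₂ - 3 * c₃) * (-c₃) - 42 * (-c₃) ^ 2) ^ 2
      - 6 * ((c₀ - 3 * c₁) ^ 2 - 7 * (-c₁) ^ 2 + 14 * (c₂ - 3 * c₃) * (-c₃) - 42 * (-c₃) ^ 2)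
          * (2 * (c₀ - 3 * c₁) * (-c₁) - 6 * (-c₁) ^ 2 - (c₂ - 3 * c₃) ^ 2 + 12 * (c₂ - 3 * c₃) * (-c₃)
              - 29 * (-c₃) ^ 2)
      + 7 * (2 * (c₀ - 3 * c₁) * (-c₁) - 6 * (-c₁) ^ 2 - (c₂ - 3 * c₃) ^ 2 + 12 * (c₂ - 3 * c₃) * (-c₃)
              - 29 * (-c₃) ^ 2) ^ 2
    = (c₀ ^ 2 - 2 * c₁ ^ 2) ^ 2 + 7 * (c₂ ^ 2 - 2 * c₃ ^ 2) ^ 2 + 6 * (c₀ * c₂ - 2 * c₁ * c₃) ^ 2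
        - 8 * (c₀ * c₂ - 2 * c₁ * c₃) * (c₁ * c₂ - c₀ * c₃) + 12 * (c₁ * c₂ - c₀ * c₃) ^ 2 := by
  ring

/-- `0 ≤ 6m² - 8mn + 12n²` (`= ((6m - 4n)² + 56n²)/6`). [folklore] -/
theorem six_sq_sub_nonneg (m n : ℤ) : 0 ≤ 6 * m ^ 2 - 8 * m * n + 12 * n ^ 2 := by
  nlinarith [sq_nonneg (3 * m - 2 * n), sq_nonneg n]

/-- **The box bound**: `|cᵢ| ≤ M ⟹ Q ≤ 182·M⁴` (`(c₀²-2c₁²)² ≤ 4M⁴`, `7(c₂²-2c₃²)² ≤ 28M⁴`, `|m| ≤ 3M²`, `|n| ≤ 2M²`).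
[folklore] -/
theorem normE_le (M : ℕ) (c₀ c₁ c₂ c₃ : ℤ) (h₀ : |c₀| ≤ M) (h₁ : |c₁| ≤ M) (h₂ : |c₂| ≤ M) (h₃ : |c₃| ≤ M) :
    (c₀ ^ 2 - 2 * c₁ ^ 2) ^ 2 + 7 * (c₂ ^ 2 - 2 * c₃ ^ 2) ^ 2 + 6 * (c₀ * c₂ - 2 * c₁ * c₃) ^ 2
        - 8 * (c₀ * c₂ - 2 * c₁ * c₃) * (c₁ * c₂ - c₀ * c₃) + 12 * (c₁ * c₂ - c₀ * c₃) ^ 2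
      ≤ 182 * (M : ℤ) ^ 4 := by
  have hM : (0 : ℤ) ≤ M := by positivity
  have s₀ : c₀ ^ 2 ≤ (M : ℤ) ^ 2 := by nlinarith [abs_le.1 h₀, sq_abs c₀]
  have s₁ : c₁ ^ 2 ≤ (M : ℤ) ^ 2 := by nlinarith [abs_le.1 h₁, sq_abs c₁]
  have s₂ : c₂ ^ 2 ≤ (M : ℤ) ^ 2 := by nlinarith [abs_le.1 h₂, sq_abs c₂]
  have s₃ : c₃ ^ 2 ≤ (M : ℤ) ^ 2 := by nlinarith [abs_le.1 h₃, sq_abs c₃]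
  have p02 : |c₀ * c₂| ≤ (M : ℤ) ^ 2 := by
    rw [abs_mul, sq]; exact mul_le_mul h₀ h₂ (abs_nonneg _) hM
  have p13 : |c₁ * c₃| ≤ (M : ℤ) ^ 2 := by
    rw [abs_mul, sq]; exact mul_le_mul h₁ h₃ (abs_nonneg _) hM
  have p12 : |c₁ * c₂| ≤ (M : ℤ) ^ 2 := by
    rw [abs_mul, sq]; exact mul_le_mul h₁ h₂ (abs_nonneg _) hM
  have p03 : |c₀ * c₃| ≤ (M : ℤ) ^ 2 := by
    rw [abs_mul, sq]; exact mul_le_mul h₀ h₃ (abs_nonneg _) hM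
  -- `|m| ≤ 3M²`, `|n| ≤ 2M²`
  have hm : |c₀ * c₂ - 2 * c₁ * c₃| ≤ 3 * (M : ℤ) ^ 2 := by
    calc |c₀ * c₂ - 2 * c₁ * c₃| ≤ |c₀ * c₂| + |2 * c₁ * c₃| := abs_sub _ _
      _ = |c₀ * c₂| + 2 * |c₁ * c₃| := by rw [mul_assoc, abs_mul]; norm_num
      _ ≤ (M : ℤ) ^ 2 + 2 * (M : ℤ) ^ 2 := by linarith
      _ = 3 * (M : ℤ) ^ 2 := by ring
  have hn : |c₁ * c₂ - c₀ * c₃| ≤ 2 * (M : ℤ) ^ 2 := by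
    calc |c₁ * c₂ - c₀ * c₃| ≤ |c₁ * c₂| + |c₀ * c₃| := abs_sub _ _
      _ ≤ (M : ℤ) ^ 2 + (M : ℤ) ^ 2 := by linarith
      _ = 2 * (M : ℤ) ^ 2 := by ring
  have t1 : (c₀ ^ 2 - 2 * c₁ ^ 2) ^ 2 ≤ 4 * (M : ℤ) ^ 4 := by
    have : |c₀ ^ 2 - 2 * c₁ ^ 2| ≤ 2 * (M : ℤ) ^ 2 := abs_le.2 ⟨by nlinarith, by nlinarith⟩
    nlinarith [abs_nonneg (c₀ ^ 2 - 2 * c₁ ^ 2), sq_abs (c₀ ^ 2 - 2 * c₁ ^ 2)]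
  have t2 : (c₂ ^ 2 - 2 * c₃ ^ 2) ^ 2 ≤ 4 * (M : ℤ) ^ 4 := by
    have : |c₂ ^ 2 - 2 * c₃ ^ 2| ≤ 2 * (M : ℤ) ^ 2 := abs_le.2 ⟨by nlinarith, by nlinarith⟩
    nlinarith [abs_nonneg (c₂ ^ 2 - 2 * c₃ ^ 2), sq_abs (c₂ ^ 2 - 2 * c₃ ^ 2)]
  have t3 : (c₀ * c₂ - 2 * c₁ * c₃) ^ 2 ≤ 9 * (M : ℤ) ^ 4 := by
    nlinarith [abs_nonneg (c₀ * c₂ - 2 * c₁ * c₃), sq_abs (c₀ * c₂ - 2 * c₁ * c₃)]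
  have t4 : (c₁ * c₂ - c₀ * c₃) ^ 2 ≤ 4 * (M : ℤ) ^ 4 := by
    nlinarith [abs_nonneg (c₁ * c₂ - c₀ * c₃), sq_abs (c₁ * c₂ - c₀ * c₃)]
  have t5 : -((c₀ * c₂ - 2 * c₁ * c₃) * (c₁ * c₂ - c₀ * c₃)) ≤ 6 * (M : ℤ) ^ 4 := by
    have h := abs_mul (c₀ * c₂ - 2 * c₁ * c₃) (c₁ * c₂ - c₀ * c₃)
    have h' : |c₀ * c₂ - 2 * c₁ * c₃| * |c₁ * c₂ - c₀ * c₃| ≤ 3 * (M : ℤ) ^ 2 * (2 * (M : ℤ) ^ 2) :=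
      mul_le_mul hm hn (abs_nonneg _) (by positivity)
    have h'' := neg_abs_le ((c₀ * c₂ - 2 * c₁ * c₃) * (c₁ * c₂ - c₀ * c₃))
    nlinarith
  nlinarith

/-- **`3(X - 3Y) = 3(A - 3B)² + 6B² + (3C - 11D)² + 14D²`**, so `X - 3Y > 0` unless `z = 0`: the norm
`Nm(z) = X + Yσ` is positive at the first real place. [folklore] -/
theorem sub_three_Y_pos (A B C D : ℤ) (hne : A ≠ 0 ∨ B ≠ 0 ∨ C ≠ 0 ∨ D ≠ 0) :
    0 < (A ^ 2 - 7 * B ^ 2 + 14 * C * D - 42 * D ^ 2) - 3 * (2 * A * B - 6 * B ^ 2 - C ^ 2 + 12 * C * D - 29 * D ^ 2) := by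
  have e : 3 * ((A ^ 2 - 7 * B ^ 2 + 14 * C * D - 42 * D ^ 2)
      - 3 * (2 * A * B - 6 * B ^ 2 - C ^ 2 + 12 * C * D - 29 * D ^ 2))
      = 3 * (A - 3 * B) ^ 2 + 6 * B ^ 2 + (3 * C - 11 * D) ^ 2 + 14 * D ^ 2 := by ring
  have hnn : 0 ≤ 3 * (A - 3 * B) ^ 2 + 6 * B ^ 2 + (3 * C - 11 * D) ^ 2 + 14 * D ^ 2 := by positivity
  have hne' : 3 * (A - 3 * B) ^ 2 + 6 * B ^ 2 + (3 * C - 11 * D) ^ 2 + 14 * D ^ 2 ≠ 0 := by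
    intro h
    have hB : B = 0 := by nlinarith [sq_nonneg (A - 3 * B), sq_nonneg (3 * C - 11 * D), sq_nonneg D]
    have hD : D = 0 := by nlinarith [sq_nonneg (A - 3 * B), sq_nonneg (3 * C - 11 * D), sq_nonneg B]
    rw [hB, hD] at h
    have hA : A = 0 := by nlinarith [sq_nonneg C]
    have hC : C = 0 := by nlinarith [sq_nonneg A]
    rcases hne with h1 | h1 | h1 | h1
    · exact h1 hA
    · exact h1 hB
    · exact h1 hC
    · exact h1 hD
  have := lt_of_le_of_ne hnn (Ne.symm hne')
  linarith

/-- **`Nm(z)` is totally positive for `z ≠ 0`**: with `X - 3Y > 0` also `N(X,Y) = (X - 3Y)² - 2Y² > 0`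
(`≥ 0` by §1's sum of squares, `≠ 0` by the irrationality of `√2`). Coordinates `A = c₀ - 3c₁`, `B = -c₁`,
`C = c₂ - 3c₃`, `D = -c₃`. [folklore] -/
theorem totPos_nm (c₀ c₁ c₂ c₃ : ℤ) (hne : c₀ ≠ 0 ∨ c₁ ≠ 0 ∨ c₂ ≠ 0 ∨ c₃ ≠ 0) {X Y : ℤ}
    (hX : (c₀ - 3 * c₁) ^ 2 - 7 * (-c₁) ^ 2 + 14 * (c₂ - 3 * c₃) * (-c₃) - 42 * (-c₃) ^ 2 = X)
    (hY : 2 * (c₀ - 3 * c₁) * (-c₁) - 6 * (-c₁) ^ 2 - (c₂ - 3 * c₃) ^ 2 + 12 * (c₂ - 3 * c₃) * (-c₃)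
      - 29 * (-c₃) ^ 2 = Y) :
    0 < X - 3 * Y ∧ 0 < X ^ 2 - 6 * X * Y + 7 * Y ^ 2 := by
  have hne' : c₀ - 3 * c₁ ≠ 0 ∨ -c₁ ≠ 0 ∨ c₂ - 3 * c₃ ≠ 0 ∨ -c₃ ≠ 0 := by
    by_contra h
    simp only [not_or, not_not] at h
    obtain ⟨h1, h2, h3, h4⟩ := h
    rcases hne with h5 | h5 | h5 | h5 <;> omega
  have h1 := sub_three_Y_pos _ _ _ _ hne'
  rw [hX, hY] at h1
  refine ⟨h1, ?_⟩
  have hnn : 0 ≤ X ^ 2 - 6 * X * Y + 7 * Y ^ 2 := by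
    rw [← hX, ← hY, normE_sos]
    have := six_sq_sub_nonneg (c₀ * c₂ - 2 * c₁ * c₃) (c₁ * c₂ - c₀ * c₃)
    nlinarith [sq_nonneg (c₀ ^ 2 - 2 * c₁ ^ 2), sq_nonneg (c₂ ^ 2 - 2 * c₃ ^ 2), this]
  rcases hnn.lt_or_eq with h | h
  · exact h
  · exfalso
    have hsq : (X - 3 * Y) ^ 2 = 2 * Y ^ 2 := by linear_combination -h
    rcases eq_or_ne Y 0 with h0 | h0
    · rw [h0] at hsq
      have : X - 3 * Y = 0 := by nlinarith
      linarith
    · have hq : ((X - 3 * Y : ℤ) : ℚ) ^ 2 = 2 * ((Y : ℤ) : ℚ) ^ 2 := by exact_mod_cast hsq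
      exact rat_sq_ne_prime_mul_sq Nat.prime_two (m := ((Y : ℤ) : ℚ)) (by exact_mod_cast h0) _
        (by rw [hq]; norm_num)

/-! ### §2 Pigeonhole for two linear forms mod `q` -/

/-- **Two-form Thue box**: for linear forms `α, β` in four variables over `𝔽_q` there is a nonzero integer vector
`c` with `|cᵢ| ≤ m`, `m² < q`, killed by both (pigeonhole on the `(m+1)⁴ > q²` points, `m = ⌊√q⌋`). [folklore] -/
theorem box_four_two {q : ℕ} [hq : Fact q.Prime] (α₀ α₁ α₂ α₃ β₀ β₁ β₂ β₃ : ZMod q) :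
    ∃ m : ℕ, m ^ 2 < q ∧ ∃ c₀ c₁ c₂ c₃ : ℤ, (c₀ ≠ 0 ∨ c₁ ≠ 0 ∨ c₂ ≠ 0 ∨ c₃ ≠ 0) ∧
      |c₀| ≤ m ∧ |c₁| ≤ m ∧ |c₂| ≤ m ∧ |c₃| ≤ m ∧
      α₀ * c₀ + α₁ * c₁ + α₂ * c₂ + α₃ * c₃ = 0 ∧ β₀ * c₀ + β₁ * c₁ + β₂ * c₂ + β₃ * c₃ = 0 := by
  classical
  obtain ⟨m, hm⟩ : ∃ m, m = Nat.sqrt q := ⟨_, rfl⟩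
  have h3 : m ^ 2 ≤ q := by rw [hm]; exact Nat.sqrt_le' q
  have h4 : q < (m + 1) ^ 2 := by rw [hm]; exact Nat.lt_succ_sqrt' q
  have hm2 : m ^ 2 < q := by
    rcases h3.lt_or_eq with h | h
    · exact h
    · exfalso
      have hdvd : m ∣ q := ⟨m, by rw [← h]; ring⟩
      have h1' := hq.out.one_lt
      rcases (Nat.dvd_prime hq.out).1 hdvd with h5 | h5
      · rw [h5] at h; omega
      · rw [h5] at h; nlinarith
  have hbox : q ^ 2 < (m + 1) ^ 4 :=
    calc q ^ 2 < ((m + 1) ^ 2) ^ 2 := Nat.pow_lt_pow_left h4 (by norm_num)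
      _ = (m + 1) ^ 4 := by ring
  let S : Finset ((ℕ × ℕ) × (ℕ × ℕ)) :=
    (Finset.range (m + 1) ×ˢ Finset.range (m + 1)) ×ˢ (Finset.range (m + 1) ×ˢ Finset.range (m + 1))
  have hS : S.card = (m + 1) ^ 4 := by simp [S, Finset.card_product]; ring
  have hlt : (Finset.univ : Finset (ZMod q × ZMod q)).card < S.card := by
    rw [Finset.card_univ, Fintype.card_prod, ZMod.card, hS, ← sq]; exact hbox
  obtain ⟨a, ha, b, hb, hne, heq⟩ := Finset.exists_ne_map_eq_of_card_lt_of_maps_to hlt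
    (f := fun w : (ℕ × ℕ) × (ℕ × ℕ) =>
      ((α₀ * w.1.1 + α₁ * w.1.2 + α₂ * w.2.1 + α₃ * w.2.2 : ZMod q),
        (β₀ * w.1.1 + β₁ * w.1.2 + β₂ * w.2.1 + β₃ * w.2.2 : ZMod q)))
    (fun _ _ => Finset.mem_coe.2 (Finset.mem_univ _))
  simp only [S, Finset.mem_product, Finset.mem_range] at ha hb
  obtain ⟨heq1, heq2⟩ := Prod.mk.inj heq
  refine ⟨m, hm2, (a.1.1 : ℤ) - b.1.1, (a.1.2 : ℤ) - b.1.2, (a.2.1 : ℤ) - b.2.1, (a.2.2 : ℤ) - b.2.2,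
    ?_, ?_, ?_, ?_, ?_, ?_, ?_⟩
  · by_contra h
    simp only [not_or, not_not] at h
    obtain ⟨h1, h2, h3', h4'⟩ := h
    exact hne (Prod.ext (Prod.ext (by omega) (by omega)) (Prod.ext (by omega) (by omega)))
  · exact abs_le.2 ⟨by omega, by omega⟩
  · exact abs_le.2 ⟨by omega, by omega⟩
  · exact abs_le.2 ⟨by omega, by omega⟩
  · exact abs_le.2 ⟨by omega, by omega⟩
  · push_cast
    linear_combination heq1
  · push_cast
    linear_combination heq2

/-! ### §3 The box for a degree-one prime split in `E` -/

/-- **The degree-one box.** `π = u + vσ` totally positive of prime norm `ℓ` with Bezout data (`πγ = t + σ`) and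
`-t = e²` a square mod `ℓ` (the place splits in `E = F(√σ)`): there are an integral `z = (A,B,C,D)` and a totally
positive `μ₀ = M₀ + M₁σ` with `Nm(z) = π·μ₀` and `0 < N(μ₀) < 182` (`z` in the prime `(π, η - e)`:
`z(σ ↦ -t, η ↦ e) = 0`, coordinates at most `m`, `m⁴ < ℓ`; then `ℓ ∣ X - tY`, so `π ∣ Nm(z)`, and
`ℓ·N(μ₀) = Nm_{E/ℚ}(z) ≤ 182m⁴ < 182ℓ`). [folklore] -/
theorem degOne_box {u v g₀ g₁ t : ℤ} {ℓ : ℕ} (hℓ : ℓ.Prime) (hN : u ^ 2 - 6 * u * v + 7 * v ^ 2 = ℓ)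
    (ht : u * g₀ - 7 * v * g₁ = t) (hγ : v * g₀ + u * g₁ - 6 * v * g₁ = 1) (hpos : 0 < u - 3 * v)
    (hsq : IsSquare (-(t : ZMod ℓ))) :
    ∃ A B C D M₀ M₁ : ℤ,
      A ^ 2 - 7 * B ^ 2 + 14 * C * D - 42 * D ^ 2 = u * M₀ - 7 * v * M₁ ∧
      2 * A * B - 6 * B ^ 2 - C ^ 2 + 12 * C * D - 29 * D ^ 2 = u * M₁ + v * M₀ - 6 * v * M₁ ∧
      0 < M₀ - 3 * M₁ ∧ 0 < M₀ ^ 2 - 6 * M₀ * M₁ + 7 * M₁ ^ 2 ∧ M₀ ^ 2 - 6 * M₀ * M₁ + 7 * M₁ ^ 2 < 182 := by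
  haveI : Fact ℓ.Prime := ⟨hℓ⟩
  have hℓ0 : (0 : ℤ) < ℓ := by exact_mod_cast hℓ.pos
  obtain ⟨e, he⟩ := hsq
  obtain ⟨m, hm4, c₀, c₁, c₂, c₃, hne, h₀, h₁, h₂, h₃, hlin⟩ := box_four ((t : ZMod ℓ) - 3) e
  -- coordinates and the norm
  obtain ⟨X, hX⟩ : ∃ X : ℤ, (c₀ - 3 * c₁) ^ 2 - 7 * (-c₁) ^ 2 + 14 * (c₂ - 3 * c₃) * (-c₃) - 42 * (-c₃) ^ 2 = X :=
    ⟨_, rfl⟩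
  obtain ⟨Y, hY⟩ : ∃ Y : ℤ, 2 * (c₀ - 3 * c₁) * (-c₁) - 6 * (-c₁) ^ 2 - (c₂ - 3 * c₃) ^ 2
      + 12 * (c₂ - 3 * c₃) * (-c₃) - 29 * (-c₃) ^ 2 = Y := ⟨_, rfl⟩
  have htp := totPos_nm c₀ c₁ c₂ c₃ hne hX hY
  -- `ℓ ∣ X - tY`
  have hroot := degOne_root hN ht hγ
  have hdvd : (ℓ : ℤ) ∣ X - t * Y := by
    rw [← ZMod.intCast_zmod_eq_zero_iff_dvd]
    push_cast
    rw [← hX, ← hY]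
    push_cast
    have hx : ((c₀ : ZMod ℓ) - 3 * c₁) - t * (-(c₁ : ZMod ℓ)) = -((c₂ : ZMod ℓ) + c₃ * ((t : ZMod ℓ) - 3)) * e := by
      linear_combination hlin
    linear_combination (((c₀ : ZMod ℓ) - 3 * c₁) - t * (-(c₁ : ZMod ℓ)) - ((c₂ : ZMod ℓ) + c₃ * ((t : ZMod ℓ) - 3)) * e) * hx
      - ((c₂ : ZMod ℓ) + c₃ * ((t : ZMod ℓ) - 3)) ^ 2 * he
      + (-(-(c₁ : ZMod ℓ)) ^ 2 + 2 * ((c₂ : ZMod ℓ) - 3 * c₃) * (-(c₃ : ZMod ℓ))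
          - ((t : ZMod ℓ) + 6) * (-(c₃ : ZMod ℓ)) ^ 2) * hroot
  obtain ⟨M₀, M₁, hM₀, hM₁⟩ := (degOne_dvd_iff hN ht hγ X Y).2 hdvd
  refine ⟨c₀ - 3 * c₁, -c₁, c₂ - 3 * c₃, -c₃, M₀, M₁, hX.trans hM₀, hY.trans hM₁, ?_⟩
  -- total positivity of `μ₀`
  rw [hM₀, hM₁] at htp
  have hposμ := totPos_cancel hpos (by rw [hN]; exact hℓ0) htp.1 htp.2
  refine ⟨hposμ.1, hposμ.2, ?_⟩
  -- the bound `ℓ·N(μ₀) = Q ≤ 182 m⁴ < 182 ℓ`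
  have hQ : (ℓ : ℤ) * (M₀ ^ 2 - 6 * M₀ * M₁ + 7 * M₁ ^ 2) ≤ 182 * (m : ℤ) ^ 4 := by
    rw [← hN, ← zs_norm_mul, ← hM₀, ← hM₁, ← hX, ← hY, normE_sos]
    exact normE_le m c₀ c₁ c₂ c₃ h₀ h₁ h₂ h₃
  have hm4' : (m : ℤ) ^ 4 < ℓ := by exact_mod_cast hm4
  nlinarith

/-! ### §4 The box for an inert rational prime split in `E` -/

/-- **A square root of `σ` mod an inert `q` from a square root of `7`** (denesting): for a prime `q ≠ 2` with `2` a
non-square and `c² = 7`, there are `e₀, e₁ ∈ 𝔽_q` with `(e₀ + e₁σ)² = σ` in `𝔽_q[σ]/(σ² + 6σ + 7)`, i.e.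
`e₀² - 7e₁² = 0` and `2e₀e₁ - 6e₁² = 1` (`e₀' ² = (-3 ± c)/2` — one sign is a square since the product `1/2` is
not —, `e₁' = -1/(2e₀')`, `e₀ = e₀' - 3e₁'`, `e₁ = -e₁'`). [folklore] -/
theorem exists_sqrt_sigma_mod_inert {q : ℕ} [hq : Fact q.Prime] (hq2 : q ≠ 2) (h2 : ¬ IsSquare (2 : ZMod q))
    (h7 : IsSquare (7 : ZMod q)) :
    ∃ e₀ e₁ : ZMod q, e₀ ^ 2 - 7 * e₁ ^ 2 = 0 ∧ 2 * e₀ * e₁ - 6 * e₁ ^ 2 = 1 := by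
  have h2' : (2 : ZMod q) ≠ 0 := by exact_mod_cast natCast_prime_ne_zero_zmod Nat.prime_two hq2
  obtain ⟨t, ht⟩ : ∃ t : ZMod q, t = 2⁻¹ := ⟨_, rfl⟩
  have hinv : 2 * t = 1 := by rw [ht]; exact mul_inv_cancel₀ h2'
  -- a square root `c` of `7` with `(-3 + c)/2` a square
  obtain ⟨c, hc, s, hs⟩ : ∃ c : ZMod q, c * c = 7 ∧ ∃ s : ZMod q, (-3 + c) * t = s * s := by
    obtain ⟨c, hc⟩ := h7
    have hc' : c * c = 7 := hc.symm
    by_cases hsq : IsSquare ((-3 + c) * t : ZMod q)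
    · obtain ⟨s, hs⟩ := hsq
      exact ⟨c, hc', s, hs⟩
    · have hprod : ¬ IsSquare (((-3 + c) * t) * ((-3 - c) * t) : ZMod q) := by
        have e : ((-3 + c) * t) * ((-3 - c) * t) = t := by
          linear_combination t * hinv - t ^ 2 * hc'
        rw [e, ht]
        rintro ⟨r, hr⟩
        refine h2 ⟨r⁻¹, ?_⟩
        rw [← mul_inv, ← hr, inv_inv]
      have hsq' : IsSquare ((-3 - c) * t : ZMod q) := by
        by_contra h
        exact hprod (isSquare_mul_of_not_isSquare hsq h)
      obtain ⟨s, hs⟩ := hsq'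
      exact ⟨-c, by linear_combination hc', s, by rw [← hs]; ring⟩
  -- `2s⁴ + 6s² + 1 = 0`
  have e4 : s ^ 2 = (-3 + c) * t := by rw [sq, ← hs]
  have key0 : 2 * s ^ 4 + 6 * s ^ 2 + 1 = 0 := by
    linear_combination (2 * s ^ 2 + 2 * (-3 + c) * t + 6) * e4 + ((-3 + c) ^ 2 * t - 1) * hinv + t * hc
  -- `e₀' = s`, `e₁' = -1/(2s) = s³ + 3s`; `e₀ = e₀' - 3e₁' = -3s³ - 8s`, `e₁ = -e₁' = -s³ - 3s`
  refine ⟨-3 * s ^ 3 - 8 * s, -s ^ 3 - 3 * s, ?_, ?_⟩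
  · linear_combination s ^ 2 * key0
  · linear_combination -key0

/-- **The inert box.** `q` prime, `2` a non-square mod `q` (inert in `F`), `7` a square mod `q` (the place `(q)`
splits in `E/F`): there are an integral `z` and a totally positive `μ₀` with `Nm(z) = q·μ₀` and
`0 < N(μ₀) < 182` (`z` in the prime `(q, η - (e₀ + e₁σ))`: two linear conditions, `box_four_two`, coordinates
at most `m`, `m² < q`; `q²·N(μ₀) = Nm_{E/ℚ}(z) ≤ 182m⁴ < 182q²`). [folklore] -/
theorem inert_box {q : ℕ} (hq : q.Prime) (hq2 : q ≠ 2) (h2 : ¬ IsSquare (2 : ZMod q))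
    (h7 : IsSquare (7 : ZMod q)) :
    ∃ A B C D M₀ M₁ : ℤ,
      A ^ 2 - 7 * B ^ 2 + 14 * C * D - 42 * D ^ 2 = (q : ℤ) * M₀ - 7 * 0 * M₁ ∧
      2 * A * B - 6 * B ^ 2 - C ^ 2 + 12 * C * D - 29 * D ^ 2 = (q : ℤ) * M₁ + 0 * M₀ - 6 * 0 * M₁ ∧
      0 < M₀ - 3 * M₁ ∧ 0 < M₀ ^ 2 - 6 * M₀ * M₁ + 7 * M₁ ^ 2 ∧ M₀ ^ 2 - 6 * M₀ * M₁ + 7 * M₁ ^ 2 < 182 := by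
  haveI : Fact q.Prime := ⟨hq⟩
  have hq0 : (0 : ℤ) < q := by exact_mod_cast hq.pos
  obtain ⟨e₀, e₁, hE₀, hE₁⟩ := exists_sqrt_sigma_mod_inert hq2 h2 h7
  -- the two linear forms `x + (e₀ + e₁σ)y ≡ 0` in the coordinates `c`
  obtain ⟨m, hm2, c₀, c₁, c₂, c₃, hne, h₀, h₁, h₂, h₃, hL₁, hL₂⟩ :=
    box_four_two (q := q) 1 (-3) e₀ (-3 * e₀ + 7 * e₁) 0 (-1) e₁ (-e₀ + 3 * e₁)
  obtain ⟨X, hX⟩ : ∃ X : ℤ, (c₀ - 3 * c₁) ^ 2 - 7 * (-c₁) ^ 2 + 14 * (c₂ - 3 * c₃) * (-c₃) - 42 * (-c₃) ^ 2 = X :=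
    ⟨_, rfl⟩
  obtain ⟨Y, hY⟩ : ∃ Y : ℤ, 2 * (c₀ - 3 * c₁) * (-c₁) - 6 * (-c₁) ^ 2 - (c₂ - 3 * c₃) ^ 2
      + 12 * (c₂ - 3 * c₃) * (-c₃) - 29 * (-c₃) ^ 2 = Y := ⟨_, rfl⟩
  have htp := totPos_nm c₀ c₁ c₂ c₃ hne hX hY
  -- `q ∣ X`, `q ∣ Y`: `x ≡ -(e₀ + e₁σ)y`, so `x² - σy² ≡ ((e₀ + e₁σ)² - σ)y² = 0`
  have hc1 : (c₁ : ZMod q) = -e₀ * c₃ + e₁ * (c₂ - 3 * c₃) + 6 * e₁ * c₃ := by linear_combination -hL₂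
  have hc0 : (c₀ : ZMod q) = 3 * (-e₀ * c₃ + e₁ * (c₂ - 3 * c₃) + 6 * e₁ * c₃) - e₀ * (c₂ - 3 * c₃) - 7 * e₁ * c₃ := by
    linear_combination hL₁ + 3 * hc1
  have hXq : (q : ℤ) ∣ X := by
    rw [← ZMod.intCast_zmod_eq_zero_iff_dvd, ← hX]
    push_cast
    rw [hc0, hc1]
    linear_combination (((c₂ : ZMod q) - 3 * c₃) ^ 2 - 7 * (-(c₃ : ZMod q)) ^ 2) * hE₀
      - 7 * (2 * ((c₂ : ZMod q) - 3 * c₃) * (-(c₃ : ZMod q)) - 6 * (-(c₃ : ZMod q)) ^ 2) * hE₁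
  have hYq : (q : ℤ) ∣ Y := by
    rw [← ZMod.intCast_zmod_eq_zero_iff_dvd, ← hY]
    push_cast
    rw [hc0, hc1]
    linear_combination (2 * ((c₂ : ZMod q) - 3 * c₃) * (-(c₃ : ZMod q)) - 6 * (-(c₃ : ZMod q)) ^ 2) * hE₀
      + ((((c₂ : ZMod q) - 3 * c₃) ^ 2 - 7 * (-(c₃ : ZMod q)) ^ 2)
          - 6 * (2 * ((c₂ : ZMod q) - 3 * c₃) * (-(c₃ : ZMod q)) - 6 * (-(c₃ : ZMod q)) ^ 2)) * hE₁
  obtain ⟨M₀, hM₀⟩ := hXq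
  obtain ⟨M₁, hM₁⟩ := hYq
  have hM₀' : X = (q : ℤ) * M₀ - 7 * 0 * M₁ := by rw [hM₀]; ring
  have hM₁' : Y = (q : ℤ) * M₁ + 0 * M₀ - 6 * 0 * M₁ := by rw [hM₁]; ring
  refine ⟨c₀ - 3 * c₁, -c₁, c₂ - 3 * c₃, -c₃, M₀, M₁, hX.trans hM₀', hY.trans hM₁', ?_⟩
  rw [hM₀', hM₁'] at htp
  have hposq : 0 < (q : ℤ) - 3 * 0 := by linarith
  have hNq : 0 < (q : ℤ) ^ 2 - 6 * q * 0 + 7 * 0 ^ 2 := by nlinarith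
  have hposμ := totPos_cancel hposq hNq htp.1 htp.2
  refine ⟨hposμ.1, hposμ.2, ?_⟩
  have hQ : ((q : ℤ) ^ 2 - 6 * q * 0 + 7 * 0 ^ 2) * (M₀ ^ 2 - 6 * M₀ * M₁ + 7 * M₁ ^ 2) ≤ 182 * (m : ℤ) ^ 4 := by
    rw [← zs_norm_mul, ← hM₀', ← hM₁', ← hX, ← hY, normE_sos]
    exact normE_le m c₀ c₁ c₂ c₃ h₀ h₁ h₂ h₃
  have hm2' : (m : ℤ) ^ 2 < q := by exact_mod_cast hm2
  have hm4 : (m : ℤ) ^ 4 < (q : ℤ) ^ 2 := by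
    have h0 : (0 : ℤ) ≤ (m : ℤ) ^ 2 := by positivity
    nlinarith
  nlinarith [hposμ.2]

end Summit.HodgeConjecture.HodgeConjecture.Ring2.WeilCoverageCM

end
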